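import Literature.LinearAlgebra.TensorNetworks.QTTCirculantInverseRanks
import Literature.LinearAlgebra.TensorNetworks.QTTCirculantExpSum

/-!
# Explicit inverses of band circulants with simple symbol roots, and their QTT representation
(Vysotsky–Rakhuba 2022: Corollary 2.1; §4 (Proposition 4.1 / Corollary 4.1 applied to `A⁻¹`);
§5.1–5.2 (the mass matrix and the shifted stiffness matrix))

Source: L. Vysotsky, M. Rakhuba, *Tensor rank bounds and explicit QTT representations for the
inverses of circulant matrices*, Numer. Linear Algebra Appl. 30(3) (2023) e2461, arXiv:2205.04335
[VysotskyRakhuba2022] (held text `paper:arxiv-2205.04335`: Corollary 2.1 p. 7, §4 pp. 10–11,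
§5 p. 12).  Continues `QTTCirculantInverseRanks` (§2 of the paper: the band circulant `bandCirc`,
the two-sided solution space `recSol`, the polynomials `gPoly`/`hPoly`, Lemma 2.1, Theorem 2.1 in
structural form, Proposition 2.1, Corollary 3.3), whose header lists "the explicit residue
constants of formula (7) / Corollary 2.1" and "§4 (explicit QTT representation of the inverse)" as
not formalised; uses `QTTCirculantExpSum` (Proposition 4.1 / Corollary 4.1: the explicit train
`expSumTrain` of a `2^L × 2^L` circulant whose first column is a sum of exponentials,
`qttMatrix_expSumTrain_prop41`, `qttMatrix_expSumTrain`).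

## The statements (verbatim, arXiv text)

(Theorem 2.1's setting: `m ≥ 2`, `A = circ(a₀, a₁, …, a_{m-1}, 0, …, 0, a_{-n}, …, a_{-1}) ∈ ℂ^{N×N}`,
`a_{m-1} ≠ 0`, `a_{-n} ≠ 0`, `g(z) ≡ ∑_{k=-n}^{m-1} a_k z^{k+n}`, `h(z) ≡ ∑_{k=-n}^{m-1} a_k z^{m-k-1}`,
"`g(z)` does not have roots on the unit circle `U`"; `z_1, …, z_s` are the roots of `g` inside `U`,
`w_1, …, w_t` those of `h` inside `U` — by Lemma 2.2 the roots of `h` are the inverses `1/z` of the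
nonzero roots of `g`.)

"**Corollary 2.1.** Under the conditions of Theorem 2.1, if both `g(z)` and `h(z)` have only simple
roots inside the unit circle `U`, then `A` is invertible and its inverse is the circulant matrix
`B ∈ ℂ^{N×N}` with elements `B_{j,ℓ} = b_{(j-ℓ) mod N}`:
`b_j = ∑_{k=1}^s 1/(g_k(z_k)(1 - z_k^N)) · z_k^{-j+n-1+N}
     + ∑_{k=1}^t 1/(h_k(w_k)(1 - w_k^N)) · w_k^{j+m-2}`,
where `g_k(z) = g(z)/(z - z_k)`, `h_k(z) = h(z)/(z - w_k)`."

§4 (p. 10): "Corollary 2.1 provides an explicit formula in case of the simple roots of `g(z)` and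
`h(z)`, which allows us to write `b_j` as a weighted sum of the exponents of the form `z_t^{±j}`.
The next proposition provides an explicit QTT representation in this case.  **Proposition 4.1.**
Let `L > 2` and consider a circulant `Â_L ∈ ℂ^{2^L × 2^L}` defined by its first column
`(Â_L)_j = α_1 w_1^j + ⋯ + α_r w_r^j`, where `α_t, w_t ∈ ℂ` […].  Then `Â_L` admits an explicit QTT
representation with the ranks `(2, r+1, r+1, …, r+1)`: `Â_L = Q_1 ⋈ Q_2 ⋈ ⋯ ⋈ Q_L` […]."
"**Corollary 4.1.** […] `(Â_L)_j = α_1 w_1^j + ⋯ + α_{r_1} w_{r_1}^j + β_1 z_1^{2^L - j} + ⋯ +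
β_{r_2} z_{r_2}^{2^L - j}` […] admits an explicit QTT representation with the ranks
`(2, r_1+r_2+1, …, r_1+r_2+1)`."  ("To avoid this issue [`|w_t^{-2^L}| ≫ 1`], we modify
Proposition 4.1 as follows.")

§5 (p. 12): "`M = circ(4, 1, 0, …, 0, 1)`, `Δ + σI = circ(2+σ, -1, 0, …, 0, -1)`" (`∈ ℝ^{N×N}`).
§5.1: "`g(z) = 1·z^0 + 4·z^1 + 1·z^2`.  Note that due to the symmetry of matrix `M`, we have
`g(z) = h(z)`.  The roots of `g(z)` are `z_1 = -2+√3` and `z_2 = -2-√3`.  The root `z_1` lies inside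
the unit circle, `z_2` lies outside, so according to Corollary 2.1, we get
`(M⁻¹)_{i,0} = […] = 1/(2√3 (1 - (√3-2)^N)) · ((√3-2)^{N-i} + (√3-2)^i)`."
§5.2: "This circulant is also symmetric, so `g(z) = h(z) = -σ² + (2+σ)z - 1` [sic; from the stencil,
`g(z) = -1 + (2+σ)z - z²`].  The roots are: `z_1 = 1 + σ/2 - √(σ²/4 + σ)`,
`z_2 = 1 + σ/2 + √(σ²/4 + σ)`.  Again, `z_1` lies inside `U` and `z_2` lies outside of it (this holds
for any `σ > 0`: obviously, `z_2 > 1`, and the product `z_1 z_2` must be equal to `1` by Vieta's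
formulas).  `((Δ + σI)⁻¹)_{i,0} = […] = 1/(√(σ² + 4σ)(1 - z_1^N)) · (z_1^{N-i} + z_1^i)`."

## What is proved here, and how (any field `K` unless stated; the paper has `K = ℂ`)

* The polynomial facts the constants need (§E, and §G for `g`): the coefficients, degree
  `m + n - 1` and leading coefficients `a_{-n}` of `h`, `a_{m-1}` of `g` (`coeff_hPoly`,
  `natDegree_hPoly`, `leadingCoeff_hPoly`, `coeff_gPoly`, …), `h(0) = a_{m-1}`, `g(0) = a_{-n}` (so
  all roots are nonzero, `ne_zero_of_eval_hPoly_eq_zero`, `ne_zero_of_eval_gPoly_eq_zero`), the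
  SIMPLE-ROOT FACTORISATIONS `h = a_{-n} ∏_k (z - w_k)`, `g = a_{m-1} ∏_k (z - z_k)` when `m + n - 1`
  distinct roots are given (`hPoly_eq_C_mul_nodal`, `gPoly_eq_C_mul_nodal`, Mathlib's
  `Lagrange.nodal`), `g(z) = 0 ⇔ h(1/z) = 0` (`eval_gPoly_eq_zero_iff`) and Vieta
  `a_{m-1} ∏_k (-z_k) = a_{-n}` (`mul_prod_neg_roots_gPoly`).
* The constants: `h_k(w_k) = a_{-n} ∏_{i≠k} (w_k - w_i)` (`hCof`) and
  `g_k(z_k) = a_{m-1} ∏_{i≠k} (z_k - z_i)` (`gCof`) — the values at the root of the paper's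
  `h_k = h/(z - w_k)`, `g_k = g/(z - z_k)` (`hCof_eq_eval_divByMonic`, `gCof_eq_eval_divByMonic`;
  equivalently `h'(w_k)`, `g'(z_k)`: `hCof_eq_eval_derivative`, `gCof_eq_eval_derivative`), nonzero
  for simple roots; and the partial-fraction / divided-difference identity behind them,
  `∑_k w_k^s / ∏_{i≠k} (w_k - w_i) = [s = d-1]` for `d` distinct nodes and `s < d`
  (`sum_pow_div_prod_sub`, from Mathlib's `Lagrange.coeff_eq_sum`; `sum_pow_div_hCof`).
* COROLLARY 2.1, ONE-FAMILY FORM over any field (§F: `bandCirc_mulVec_simpleRootCol`,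
  `inv_bandCirc_eq_circulant_simpleRootCol`, `isUnit_det_bandCirc_of_simpleRoots`, the entries
  `inv_bandCirc_apply_of_simpleRoots`, and without `mod`: `inv_bandCirc_apply_of_le` / `_of_lt`):
  let `m ≥ 2`, `a_{m-1} ≠ 0 ≠ a_{-n}`, `m + n - 1 ≤ N`, and let `w_0, …, w_{m+n-2}` be `m + n - 1`
  DISTINCT roots of `h` with `w_k^N ≠ 1`.  Then `A` is invertible, `A⁻¹ = circ(b)` with
  `b_j = ∑_k w_k^{j+m-2} / (h_k(w_k)(1 - w_k^N))` (`simpleRootCol`), i.e.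
  `(A⁻¹)_{ij} = b_{(i-j) mod N}`.  This is the printed formula with EVERY root entered through the
  `h`-family: the two printed sums are termwise equal root by root (next item), the paper merely
  choosing for each root the representative inside `U` (numerical robustness, cf. its §4 remark).
  Proof (ours, residue-free — the paper integrates `z^{j-k-1}/f(z)` over `U`):
  `E_ℓ = ∑_k w_k^{ℓ+m-2}/(h_k(w_k)(1 - w_k^N))` (`simpleRootSeq`) solves the two-sided band
  recurrence since each `w_k^ℓ` does (`simpleRootSeq_mem_recSol`, `zpow_mem_recSol_bandCoeff_iff`);
  its period defect is `D_ℓ = E_{ℓ+N} - E_ℓ = -∑_k w_k^{ℓ+m-2}/h_k(w_k)` (`simpleRootSeq_add_period`),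
  which by the divided-difference identity VANISHES for `-(m-2) ≤ ℓ ≤ n-1` and equals `-1/a_{-n}` at
  `ℓ = n` (`sum_zpow_div_hCof_eq_zero`, `sum_zpow_div_hCof_eq_inv`); the band relation of `D` at `0`
  then forces `a_{m-1} D_{-(m-1)} = 1`.  Reading the periodic vector `b = E|_{[0,N)}` through one
  wrap (`m + n - 1 ≤ N`), `∑_k a_k b_{(i-k) mod N} - [i = 0] = (band relation of E) + (boundary
  defects) = 0` for every row `i`, i.e. `A b = e₁`; then `A⁻¹ = circ(b)` by Lemma 2.1 /
  `inv_bandCirc_eq_circulant` of the §2 file.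
* COROLLARY 2.1 WITH BOTH FAMILIES (§G: `inv_bandCirc_apply_eq_sum_add_sum`): for the `m + n - 1`
  distinct roots `z_k` of `g` (`z_k^N ≠ 1`), `w_k = 1/z_k`, and ANY index set `S`,
  `(A⁻¹)_{ij} = ∑_{k∈S} z_k^{-l+n-1+N}/(g_k(z_k)(1 - z_k^N))
              + ∑_{k∉S} w_k^{l+m-2}/(h_k(w_k)(1 - w_k^N))`, `l = (i-j) mod N`,
  via the termwise identity `inv_root_term_eq`
  (`w_k^{l+m-2}/(h_k(w_k)(1-w_k^N)) = z_k^{-l+n-1+N}/(g_k(z_k)(1-z_k^N))`, `0 ≤ l < N`), itself from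
  the relation `h_k(w_k) z_k^{m+n-2} = -g_k(z_k) z_k` between the two constants (`hCof_inv_mul_pow`,
  by Vieta).  COROLLARY 2.1 AS PRINTED, over `ℂ` (`inv_bandCirc_apply_complex`,
  `isUnit_det_bandCirc_complex`): `S = {k : |z_k| < 1}`, complement `= {k : |w_k| < 1}` when no root
  lies on `U`, and `|z_k| ≠ 1 ⇒ z_k^N ≠ 1`; hypotheses: `m ≥ 2`, `a_{m-1} ≠ 0 ≠ a_{-n}`,
  `m + n - 1 ≤ N`, the `m + n - 1` roots of `g` distinct, none on `U` — which is exactly "`g` has no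
  roots on `U` and `g`, `h` have only simple roots inside `U`" (the roots of `h` inside `U` are the
  inverses of the roots of `g` outside `U`, with the same multiplicities).
* §4 APPLIED TO `A⁻¹` (§H: `inv_bandCirc_eq_qttMatrix_expSumTrain`, ranks `r_expSumTrain_roots`):
  for `N = 2^L ≥ m + n - 1`, `A⁻¹` IS the matrix of the explicit train `expSumTrain` of
  Proposition 4.1 with the `r = m + n - 1` nodes `w_k` and weights
  `α_k = w_k^{m-2}/(h_k(w_k)(1 - w_k^N))` (all QTT ranks `m + n`, matching Corollary 3.3); and in
  the robust form of Corollary 4.1 (`inv_bandCirc_eq_qttMatrix_expSumTrain_flag`): any set of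
  roots may instead be entered reversed,
  as `β_k z_k^{2^L - j}` with `z_k = 1/w_k`, `β_k = w_k^{m-2} w_k^{2^L}/(h_k(w_k)(1 - w_k^{2^L}))`.
* §5 over `ℝ` (§I): the symmetric three-point stencil `circ(a₀, a₁, 0, …, 0, a₁)` (`m = 2`, `n = 1`,
  `g = h = a₁ z² + a₀ z + a₁`) with a root `z`, `z² ≠ 1`, `z^N ≠ 1`, has
  `A⁻¹ = circ((z^{N-i} + z^i)/(a₁ (z - 1/z)(1 - z^N)))` (`inv_bandCirc_two_one_symm`, roots `z, 1/z`);
  §5.1 `M = circ(4,1,0,…,0,1)`: `(M⁻¹) = circ(((√3-2)^{N-i} + (√3-2)^i)/(2√3 (1 - (√3-2)^N)))`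
  (`inv_massMatrix`, `N ≥ 2`); §5.2 `Δ + σI = circ(2+σ,-1,0,…,0,-1)`, `σ > 0`:
  `(Δ + σI)⁻¹ = circ((z_1^{N-i} + z_1^i)/(√(σ²+4σ)(1 - z_1^N)))`, `z_1 = 1 + σ/2 - √(σ²/4 + σ)`
  (`inv_shiftedStiffness`, `N ≥ 2`).

GENERALITY.  Everything except the two `ℂ` statements and §5 holds over an arbitrary field, for
roots `w_k` anywhere (`w_k^N ≠ 1` replaces "inside `U`"; on `U` minus the `N`-th roots of unity the
formula still inverts `A`, consistent with Proposition 2.1).  The size hypothesis is `m + n - 1 ≤ N`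
(one wrap of the stencil), slightly weaker than the shape (2) of the paper, which needs `m + n ≤ N`.

Not formalised here: multiple roots (the general formula (7) of Theorem 2.1 with its polynomial
weights `c_{g,k,p'} (-j+n-1+N)^{p'}`), the contour-integral derivation (Lemma 2.2, residues), the
core-by-core matrices `Q_k` of Proposition 4.1 beyond what `QTTCirculantExpSum` provides, and §5.3
(the pseudoinverse `Δ⁺`, QTT ranks `≤ 4`).  The case `m = 1` is outside Theorem 2.1 (for `m = 1`
the analogous one-family formula is false: the stencil based at row `0` is inhomogeneous).

AI-produced formalisation (H21 engines group, seat eng-quad-2, 2026-08-23); statements checked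
against the arXiv text; no facts, no axioms beyond Mathlib's, no `sorry`.
-/

open Matrix Finset

universe u

namespace Literature.LinearAlgebra.TensorNetworks.BandCirculant

open Polynomial

/-! ## E. The characteristic polynomial `h`: coefficients, degree, simple-root factorisation -/

section HPolyFacts

variable {K : Type u} [Field K] {m n : ℕ}

/-- [cite: VysotskyRakhuba2022, Thm. 2.1 (proof)]
The coefficients of `h(z) = ∑_k a_k z^{m-1-k}` are the band coefficients `c_r = a_{m-1-r}`. -/
theorem coeff_hPoly (hmn : 1 ≤ m + n) (a : ℤ → K) (r : Fin (m + n - 1 + 1)) :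
    (hPoly m n a).coeff (r : ℕ) = bandCoeff m n a r := by
  rw [hPoly_eq_sum_bandCoeff hmn, finsetSum_coeff]
  simp only [coeff_C_mul_X_pow]
  rw [Finset.sum_eq_single r (fun r' _ hr' => if_neg fun h => hr' (Fin.ext h).symm)
    (fun h => absurd (Finset.mem_univ r) h), if_pos rfl]

/-- [cite: VysotskyRakhuba2022, Thm. 2.1 (proof)] `deg h ≤ m + n - 1`. -/
theorem natDegree_hPoly_le (hmn : 1 ≤ m + n) (a : ℤ → K) :
    (hPoly m n a).natDegree ≤ m + n - 1 := by
  rw [hPoly_eq_sum_bandCoeff hmn]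
  refine Polynomial.natDegree_sum_le_of_forall_le _ _ fun r _ => ?_
  have hr := r.isLt
  exact (natDegree_C_mul_X_pow_le _ _).trans (by omega)

/-- [cite: VysotskyRakhuba2022, Thm. 2.1 (proof)]
"a polynomial of degree `m + n - 1`": for `a_{-n} ≠ 0`, `deg h = m + n - 1`. -/
theorem natDegree_hPoly (hmn : 1 ≤ m + n) {a : ℤ → K} (hbot : a (-(n : ℤ)) ≠ 0) :
    (hPoly m n a).natDegree = m + n - 1 := by
  refine natDegree_eq_of_le_of_coeff_ne_zero (natDegree_hPoly_le hmn a) ?_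
  have h := coeff_hPoly hmn a (Fin.last (m + n - 1))
  rw [Fin.val_last, bandCoeff_last m n hmn] at h
  rwa [h]

/-- [cite: VysotskyRakhuba2022, Thm. 2.1 (proof)] The leading coefficient of `h` is `a_{-n}`. -/
theorem leadingCoeff_hPoly (hmn : 1 ≤ m + n) {a : ℤ → K} (hbot : a (-(n : ℤ)) ≠ 0) :
    (hPoly m n a).leadingCoeff = a (-(n : ℤ)) := by
  have h := coeff_hPoly hmn a (Fin.last (m + n - 1))
  rw [Fin.val_last, bandCoeff_last m n hmn] at h
  rw [leadingCoeff, natDegree_hPoly hmn hbot, h]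

/-- [cite: VysotskyRakhuba2022, Thm. 2.1 (proof)] `h ≠ 0` when `a_{-n} ≠ 0`. -/
theorem hPoly_ne_zero (hmn : 1 ≤ m + n) {a : ℤ → K} (hbot : a (-(n : ℤ)) ≠ 0) :
    hPoly m n a ≠ 0 :=
  leadingCoeff_ne_zero.mp (by rw [leadingCoeff_hPoly hmn hbot]; exact hbot)

/-- [cite: VysotskyRakhuba2022, Thm. 2.1 (proof)] `h(0) = a_{m-1}` (the constant coefficient). -/
theorem eval_zero_hPoly (hmn : 1 ≤ m + n) (a : ℤ → K) :
    (hPoly m n a).eval 0 = a ((m : ℤ) - 1) := by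
  rw [← coeff_zero_eq_eval_zero]
  have h := coeff_hPoly hmn a 0
  rw [Fin.val_zero, bandCoeff_zero] at h
  exact h

/-- [cite: VysotskyRakhuba2022, Thm. 2.1 (WLOG `a_{m-1} ≠ 0`)]
With `a_{m-1} ≠ 0`, `0` is not a root of `h`: every root `w_k` is nonzero (so `z = 1/w` makes
sense, Lemma 2.2). -/
theorem ne_zero_of_eval_hPoly_eq_zero (hmn : 1 ≤ m + n) {a : ℤ → K}
    (htop : a ((m : ℤ) - 1) ≠ 0) {w : K} (hw : (hPoly m n a).eval w = 0) : w ≠ 0 := by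
  rintro rfl
  rw [eval_zero_hPoly hmn a] at hw
  exact htop hw

/-- [cite: VysotskyRakhuba2022, Cor. 2.1 (proof)]
SIMPLE ROOTS: if `w_0, …, w_{m+n-2}` are `m + n - 1` distinct roots of `h` (all of them, `h`
having degree `m + n - 1`), then `h(z) = a_{-n} ∏_k (z - w_k)`. -/
theorem hPoly_eq_C_mul_nodal (hmn : 1 ≤ m + n) {a : ℤ → K} (hbot : a (-(n : ℤ)) ≠ 0)
    {u : Fin (m + n - 1) → K} (hu : Function.Injective u)
    (hroot : ∀ k, (hPoly m n a).eval (u k) = 0) :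
    hPoly m n a = C (a (-(n : ℤ))) * Lagrange.nodal univ u := by
  have hnd := natDegree_hPoly hmn hbot
  have hlc := leadingCoeff_hPoly hmn hbot
  have hdeg : (hPoly m n a).degree = ((m + n - 1 : ℕ) : WithBot ℕ) := by
    rw [degree_eq_natDegree (hPoly_ne_zero hmn hbot), hnd]
  refine Polynomial.eq_of_degree_le_of_eval_index_eq (v := u) univ hu.injOn ?_ ?_ ?_ ?_
  · rw [hdeg, card_univ, Fintype.card_fin]
  · rw [hdeg, degree_C_mul hbot, Lagrange.degree_nodal, card_univ, Fintype.card_fin]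
  · rw [hlc, leadingCoeff_mul, leadingCoeff_C, Lagrange.nodal_monic.leadingCoeff, mul_one]
  · intro k _
    rw [hroot k, eval_mul, Lagrange.eval_nodal_at_node (Finset.mem_univ k), mul_zero]

end HPolyFacts

/-! ## F. Corollary 2.1: the constants `1 / (h_k(w_k) (1 - w_k^N))` and the explicit inverse -/

section SimpleRoots

variable {K : Type u} [Field K] {d : ℕ}

/-- [cite: VysotskyRakhuba2022, Cor. 2.1]
`h_k(w_k)` for `h_k(z) = h(z)/(z - w_k)`: with all the (simple) roots `w_0, …, w_{d-1}` of `h`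
listed, `h_k(w_k) = a_{-n} ∏_{j ≠ k} (w_k - w_j)` (`= h'(w_k)`, `hCof_eq_eval_derivative`;
`= (h /ₘ (X - w_k))(w_k)`, `hCof_eq_eval_divByMonic`). -/
def hCof (n : ℕ) (a : ℤ → K) (u : Fin d → K) (k : Fin d) : K :=
  a (-(n : ℤ)) * ∏ j ∈ univ.erase k, (u k - u j)

/-- [cite: VysotskyRakhuba2022, Cor. 2.1] `h_k(w_k) ≠ 0` for simple roots (`a_{-n} ≠ 0`). -/
theorem hCof_ne_zero {n : ℕ} {a : ℤ → K} (hbot : a (-(n : ℤ)) ≠ 0) {u : Fin d → K}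
    (hu : Function.Injective u) (k : Fin d) : hCof n a u k ≠ 0 := by
  refine mul_ne_zero hbot (Finset.prod_ne_zero_iff.mpr fun j hj => ?_)
  exact sub_ne_zero.mpr fun h => (Finset.mem_erase.mp hj).1 (hu h).symm

/-- [cite: VysotskyRakhuba2022, Cor. 2.1 (proof)]
DIVIDED DIFFERENCES AT SIMPLE NODES (the partial-fraction identity behind the constants of
Corollary 2.1; standard): for `d` distinct nodes and `s < d`,
`∑_k u_k^s / ∏_{j≠k} (u_k - u_j) = [s = d - 1]`. -/
theorem sum_pow_div_prod_sub (u : Fin d → K) (hu : Function.Injective u) {s : ℕ} (hs : s < d) :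
    ∑ k, u k ^ s / ∏ j ∈ univ.erase k, (u k - u j) = if s = d - 1 then 1 else 0 := by
  have h := Lagrange.coeff_eq_sum (s := (univ : Finset (Fin d))) (v := u) hu.injOn
    (P := (X : K[X]) ^ s) (by
      rw [degree_X_pow, card_univ, Fintype.card_fin]
      exact_mod_cast hs)
  simp only [eval_pow, eval_X, card_univ, Fintype.card_fin, coeff_X_pow] at h
  rw [← h]
  exact if_congr eq_comm rfl rfl

/-- [cite: VysotskyRakhuba2022, Cor. 2.1 (proof)]
The same with the constants `h_k(w_k)`: `∑_k w_k^s / h_k(w_k) = [s = d-1] / a_{-n}` (`s < d`). -/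
theorem sum_pow_div_hCof (n : ℕ) (a : ℤ → K) {u : Fin d → K}
    (hu : Function.Injective u) {s : ℕ} (hs : s < d) :
    ∑ k, u k ^ s / hCof n a u k = if s = d - 1 then (a (-(n : ℤ)))⁻¹ else 0 := by
  have h := sum_pow_div_prod_sub u hu hs
  have e : ∀ k, u k ^ s / hCof n a u k =
      (a (-(n : ℤ)))⁻¹ * (u k ^ s / ∏ j ∈ univ.erase k, (u k - u j)) := fun k => by
    rw [hCof, mul_comm (a _) _, ← div_div, div_eq_mul_inv _ (a _), mul_comm]
  rw [Finset.sum_congr rfl fun k _ => e k, ← Finset.mul_sum, h, mul_ite, mul_one, mul_zero]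

variable {m n : ℕ}

/-- [cite: VysotskyRakhuba2022, Cor. 2.1] `h_k(w_k) = h'(w_k)`. -/
theorem hCof_eq_eval_derivative (hmn : 1 ≤ m + n) {a : ℤ → K} (hbot : a (-(n : ℤ)) ≠ 0)
    {u : Fin (m + n - 1) → K} (hu : Function.Injective u)
    (hroot : ∀ k, (hPoly m n a).eval (u k) = 0) (k : Fin (m + n - 1)) :
    hCof n a u k = (derivative (hPoly m n a)).eval (u k) := by
  rw [hPoly_eq_C_mul_nodal hmn hbot hu hroot, derivative_C_mul, eval_mul, eval_C,
    Lagrange.eval_nodal_derivative_eval_node_eq (Finset.mem_univ k), Lagrange.eval_nodal, hCof]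

/-- [cite: VysotskyRakhuba2022, Cor. 2.1]
`h_k(w_k)` is the value at `w_k` of `h_k(z) = h(z)/(z - w_k)` (exact polynomial division). -/
theorem hCof_eq_eval_divByMonic (hmn : 1 ≤ m + n) {a : ℤ → K} (hbot : a (-(n : ℤ)) ≠ 0)
    {u : Fin (m + n - 1) → K} (hu : Function.Injective u)
    (hroot : ∀ k, (hPoly m n a).eval (u k) = 0) (k : Fin (m + n - 1)) :
    hCof n a u k = (hPoly m n a /ₘ (X - C (u k))).eval (u k) := by
  rw [hPoly_eq_C_mul_nodal hmn hbot hu hroot, Lagrange.nodal_eq_mul_nodal_erase (Finset.mem_univ k),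
    mul_left_comm, mul_divByMonic_cancel_left _ (monic_X_sub_C _), eval_mul, eval_C,
    Lagrange.eval_nodal, hCof]

/-- [cite: VysotskyRakhuba2022, Cor. 2.1]
THE FIRST COLUMN OF `A⁻¹` FOR SIMPLE ROOTS, in terms of all the roots `w_0, …, w_{m+n-2}` of `h`:
`b_i = ∑_k w_k^{i+m-2} / (h_k(w_k) (1 - w_k^N))`, `i = 0, …, N-1`. -/
def simpleRootCol (N m n : ℕ) (a : ℤ → K) (u : Fin (m + n - 1) → K) : Fin N → K :=
  fun i => ∑ k, u k ^ ((i : ℕ) + (m - 2)) / (hCof n a u k * (1 - u k ^ N))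

/-- [cite: VysotskyRakhuba2022, Cor. 2.1 (proof)]
The same expression read as a two-sided sequence `E_ℓ = ∑_k w_k^{ℓ+m-2} / (h_k(w_k)(1 - w_k^N))`,
`ℓ ∈ ℤ` — a solution of the band recurrence (formula (7) with `P_k` constant). -/
def simpleRootSeq (N m n : ℕ) (a : ℤ → K) (u : Fin (m + n - 1) → K) : ℤ → K :=
  fun ℓ => ∑ k, u k ^ (ℓ + ((m - 2 : ℕ) : ℤ)) / (hCof n a u k * (1 - u k ^ N))

/-- [cite: VysotskyRakhuba2022, Cor. 2.1 (proof)] `b_i = E_i` on `0 ≤ i < N`. -/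
theorem simpleRootCol_eq_simpleRootSeq (N : ℕ) (a : ℤ → K) (u : Fin (m + n - 1) → K)
    (y : Fin N) : simpleRootCol N m n a u y = simpleRootSeq N m n a u ((y : ℕ) : ℤ) := by
  unfold simpleRootCol simpleRootSeq
  refine Finset.sum_congr rfl fun k _ => ?_
  rw [← Nat.cast_add, zpow_natCast]

/-- [cite: VysotskyRakhuba2022, Cor. 2.1 (proof)]
`E` solves the homogeneous band system `∑_k a_k E_{i-k} = 0` (`i ∈ ℤ`): each `w_k^ℓ` does
(`zpow_mem_recSol_bandCoeff_iff`). -/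
theorem simpleRootSeq_mem_recSol {N : ℕ} (hmn : 1 ≤ m + n) {a : ℤ → K}
    {u : Fin (m + n - 1) → K} (hu0 : ∀ k, u k ≠ 0)
    (hroot : ∀ k, (hPoly m n a).eval (u k) = 0) :
    simpleRootSeq N m n a u ∈ recSol (bandCoeff m n a) := by
  have hk : ∀ k, (fun ℓ : ℤ => u k ^ (ℓ + ((m - 2 : ℕ) : ℤ)) / (hCof n a u k * (1 - u k ^ N))) ∈
      recSol (bandCoeff m n a) := by
    intro k
    have hg := (zpow_mem_recSol_bandCoeff_iff (a := a) hmn (hu0 k)).2 (hroot k)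
    have hs := Submodule.smul_mem (recSol (bandCoeff m n a))
      (u k ^ ((m - 2 : ℕ) : ℤ) / (hCof n a u k * (1 - u k ^ N))) hg
    convert hs using 1
    funext ℓ
    simp only [Pi.smul_apply, smul_eq_mul]
    rw [zpow_add₀ (hu0 k)]
    ring
  have hsum := Submodule.sum_mem (recSol (bandCoeff m n a)) (t := (univ : Finset (Fin (m + n - 1))))
    fun k _ => hk k
  convert hsum using 1
  funext ℓ
  simp only [simpleRootSeq, Finset.sum_apply]

/-- [cite: VysotskyRakhuba2022, Cor. 2.1 (proof)]
The period defect of `E`: `E_{ℓ+N} - E_ℓ = -∑_k w_k^{ℓ+m-2} / h_k(w_k)` (the factors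
`1/(1 - w_k^N)` are exactly what makes the periodisation of `E` solve `A ξ = e₁`). -/
theorem simpleRootSeq_add_period {N : ℕ} {a : ℤ → K} (hbot : a (-(n : ℤ)) ≠ 0)
    {u : Fin (m + n - 1) → K} (hu : Function.Injective u) (hu0 : ∀ k, u k ≠ 0)
    (hN1 : ∀ k, u k ^ N ≠ 1) (ℓ : ℤ) :
    simpleRootSeq N m n a u (ℓ + N) - simpleRootSeq N m n a u ℓ =
      -∑ k, u k ^ (ℓ + ((m - 2 : ℕ) : ℤ)) / hCof n a u k := by
  unfold simpleRootSeq
  rw [← Finset.sum_sub_distrib, ← Finset.sum_neg_distrib]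
  refine Finset.sum_congr rfl fun k _ => ?_
  have hc := hCof_ne_zero hbot hu k
  have h1 : (1 - u k ^ N) ≠ 0 := sub_ne_zero.mpr (hN1 k).symm
  rw [show ℓ + (N : ℤ) + ((m - 2 : ℕ) : ℤ) = (ℓ + ((m - 2 : ℕ) : ℤ)) + ((N : ℕ) : ℤ) by ring,
    zpow_add₀ (hu0 k), zpow_natCast, div_sub_div_same,
    show u k ^ (ℓ + ((m - 2 : ℕ) : ℤ)) * u k ^ N - u k ^ (ℓ + ((m - 2 : ℕ) : ℤ)) =
      -(u k ^ (ℓ + ((m - 2 : ℕ) : ℤ)) * (1 - u k ^ N)) by ring,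
    neg_div, mul_div_mul_right _ _ h1]

/-- [cite: VysotskyRakhuba2022, Cor. 2.1 (proof)]
Inside the window `-(m-2) ≤ ℓ ≤ n-1` the defect vanishes: `∑_k w_k^{ℓ+m-2}/h_k(w_k) = 0`
(divided differences of `z^s`, `s ≤ m+n-3`, at `m+n-1` nodes). -/
theorem sum_zpow_div_hCof_eq_zero (hm : 2 ≤ m) (a : ℤ → K)
    {u : Fin (m + n - 1) → K} (hu : Function.Injective u) {ℓ : ℤ}
    (h1 : -((m : ℤ) - 2) ≤ ℓ) (h2 : ℓ ≤ (n : ℤ) - 1) :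
    ∑ k, u k ^ (ℓ + ((m - 2 : ℕ) : ℤ)) / hCof n a u k = 0 := by
  obtain ⟨s, hs⟩ : ∃ s : ℕ, ℓ + ((m - 2 : ℕ) : ℤ) = s :=
    ⟨(ℓ + ((m - 2 : ℕ) : ℤ)).toNat, by omega⟩
  simp only [hs, zpow_natCast]
  rw [sum_pow_div_hCof n a hu (by omega : s < m + n - 1), if_neg (by omega)]

/-- [cite: VysotskyRakhuba2022, Cor. 2.1 (proof)]
At the edge `ℓ = n` the defect is `∑_k w_k^{m+n-2}/h_k(w_k) = 1/a_{-n}` (the top divided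
difference of `z^{m+n-2}`). -/
theorem sum_zpow_div_hCof_eq_inv (hm : 2 ≤ m) (a : ℤ → K)
    {u : Fin (m + n - 1) → K} (hu : Function.Injective u) :
    ∑ k, u k ^ ((n : ℤ) + ((m - 2 : ℕ) : ℤ)) / hCof n a u k = (a (-(n : ℤ)))⁻¹ := by
  rw [← Nat.cast_add]
  simp only [zpow_natCast]
  rw [sum_pow_div_hCof n a hu (by omega : n + (m - 2) < m + n - 1), if_pos (by omega)]

variable {N : ℕ} [NeZero N]

/-- [cite: VysotskyRakhuba2022, Cor. 2.1]
COROLLARY 2.1 (linear-system form, over any field).  Let `m ≥ 2`, `a_{m-1} ≠ 0 ≠ a_{-n}`,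
`m + n - 1 ≤ N`, and let `w_0, …, w_{m+n-2}` be `m + n - 1` distinct roots of `h` (so all roots of
`h` are simple) with `w_k^N ≠ 1`.  Then the vector `b_i = ∑_k w_k^{i+m-2} / (h_k(w_k)(1 - w_k^N))`
solves `A b = e₁`. -/
theorem bandCirc_mulVec_simpleRootCol (hm : 2 ≤ m) (hN : m + n - 1 ≤ N) {a : ℤ → K}
    (htop : a ((m : ℤ) - 1) ≠ 0) (hbot : a (-(n : ℤ)) ≠ 0) {u : Fin (m + n - 1) → K}
    (hu : Function.Injective u) (hroot : ∀ k, (hPoly m n a).eval (u k) = 0)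
    (hN1 : ∀ k, u k ^ N ≠ 1) :
    bandCirc N m n a *ᵥ simpleRootCol N m n a u = Pi.single 0 1 := by
  have hmn : 1 ≤ m + n := by omega
  have hu0 : ∀ k, u k ≠ 0 := fun k => ne_zero_of_eval_hPoly_eq_zero hmn htop (hroot k)
  set E : ℤ → K := simpleRootSeq N m n a u with hEdef
  have hE : E ∈ recSol (bandCoeff m n a) := simpleRootSeq_mem_recSol hmn hu0 hroot
  -- the period defect `D ℓ = E (ℓ + N) - E ℓ`
  set D : ℤ → K := fun ℓ => E (ℓ + N) - E ℓ with hDdef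
  have hD : D ∈ recSol (bandCoeff m n a) :=
    Submodule.sub_mem _ (shift_mem_recSol hE (N : ℤ)) hE
  have hErel := (mem_recSol_bandCoeff_iff hmn a E).1 hE
  have hDrel := (mem_recSol_bandCoeff_iff hmn a D).1 hD
  have hDform : ∀ ℓ, D ℓ = -∑ k, u k ^ (ℓ + ((m - 2 : ℕ) : ℤ)) / hCof n a u k := fun ℓ =>
    simpleRootSeq_add_period hbot hu hu0 hN1 ℓ
  have hD0 : ∀ ℓ : ℤ, -((m : ℤ) - 2) ≤ ℓ → ℓ ≤ (n : ℤ) - 1 → D ℓ = 0 := fun ℓ h1 h2 => by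
    rw [hDform, sum_zpow_div_hCof_eq_zero hm a hu h1 h2, neg_zero]
  have hDn : D n = -(a (-(n : ℤ)))⁻¹ := by
    rw [hDform, sum_zpow_div_hCof_eq_inv hm a hu]
  -- the band relation of `D` at `i = 0` pins down `a_{m-1} D(-(m-1)) = 1`
  have hDm : a ((m : ℤ) - 1) * D (-((m : ℤ) - 1)) = 1 := by
    have h0 := hDrel 0
    have hmem1 : (-(n : ℤ)) ∈ Icc (-(n : ℤ)) ((m : ℤ) - 1) := by rw [mem_Icc]; omega
    have hmem2 : (m : ℤ) - 1 ∈ (Icc (-(n : ℤ)) ((m : ℤ) - 1)).erase (-(n : ℤ)) := by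
      rw [mem_erase, mem_Icc]; omega
    have hrest : ∑ k ∈ ((Icc (-(n : ℤ)) ((m : ℤ) - 1)).erase (-(n : ℤ))).erase ((m : ℤ) - 1),
        a k * D (0 - k) = 0 := by
      refine Finset.sum_eq_zero fun k hk => ?_
      rw [mem_erase, mem_erase, mem_Icc] at hk
      rw [zero_sub, hD0 (-k) (by omega) (by omega), mul_zero]
    rw [← Finset.add_sum_erase _ _ hmem1, ← Finset.add_sum_erase _ _ hmem2, hrest, add_zero] at h0
    simp only [zero_sub, neg_neg] at h0
    rw [hDn, mul_neg, mul_inv_cancel₀ hbot] at h0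
    linear_combination h0
  -- reading `pmod N ℓ` back in `ℤ` on the three ranges
  have hpm : ∀ ℓ t : ℤ, 0 ≤ ℓ + t * N → ℓ + t * N < N →
      (((pmod N ℓ : Fin N) : ℕ) : ℤ) = ℓ + t * N := fun ℓ t h0 h1 => by
    rw [(pmod_eq_pmod_iff ℓ (ℓ + t * N)).2 ⟨-t, by ring⟩, coe_pmod_of_lt h0 h1]
  have hcol : ∀ y : Fin N, simpleRootCol N m n a u y = E ((y : ℕ) : ℤ) :=
    simpleRootCol_eq_simpleRootSeq N a u
  funext x
  rw [bandCirc_mulVec, Pi.single_apply]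
  have hx := x.isLt
  -- termwise: `b_{(i-k) mod N} = E (i - k)` except for the single wrapped term `k = m-1, i = 0`
  have hterm : ∀ k ∈ Icc (-(n : ℤ)) ((m : ℤ) - 1),
      a k * simpleRootCol N m n a u (pmod N (((x : ℕ) : ℤ) - k)) =
        a k * E (((x : ℕ) : ℤ) - k) +
          if k = (m : ℤ) - 1 then (if (x : ℕ) = 0 then a k * D (-((m : ℤ) - 1)) else 0) else 0 := by
    intro k hk
    rw [mem_Icc] at hk
    rw [hcol]
    rcases lt_or_ge (((x : ℕ) : ℤ) - k) 0 with hneg | hnonneg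
    · -- wrapped below: `(i - k) mod N = i - k + N`
      rw [hpm _ 1 (by omega) (by omega), one_mul,
        show E (((x : ℕ) : ℤ) - k + N) = E (((x : ℕ) : ℤ) - k) + D (((x : ℕ) : ℤ) - k) by
          simp only [hDdef]; ring]
      by_cases hkm : k = (m : ℤ) - 1 ∧ (x : ℕ) = 0
      · obtain ⟨rfl, hx0⟩ := hkm
        rw [if_pos rfl, if_pos hx0, mul_add, hx0]
        simp
      · rw [hD0 _ (by omega) (by omega), add_zero]
        rcases not_and_or.mp hkm with h | h
        · rw [if_neg h, add_zero]
        · by_cases hkm' : k = (m : ℤ) - 1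
          · rw [if_pos hkm', if_neg h, add_zero]
          · rw [if_neg hkm', add_zero]
    · rcases lt_or_ge (((x : ℕ) : ℤ) - k) N with hlt | hbig
      · -- no wrap
        rw [hpm _ 0 (by omega) (by omega), zero_mul, add_zero]
        by_cases hkm' : k = (m : ℤ) - 1
        · rw [if_pos hkm', if_neg (by omega), add_zero]
        · rw [if_neg hkm', add_zero]
      · -- wrapped above: `(i - k) mod N = i - k - N`
        rw [hpm _ (-1) (by omega) (by omega), neg_one_mul, ← sub_eq_add_neg,
          show E (((x : ℕ) : ℤ) - k - N) = E (((x : ℕ) : ℤ) - k) - D (((x : ℕ) : ℤ) - k - N) by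
            simp only [hDdef]; ring_nf,
          hD0 _ (by omega) (by omega), sub_zero, if_neg (by omega), add_zero]
  rw [Finset.sum_congr rfl hterm, Finset.sum_add_distrib, hErel, zero_add, Finset.sum_ite_eq',
    if_pos (by rw [mem_Icc]; omega)]
  by_cases hx0 : (x : ℕ) = 0
  · rw [if_pos hx0, hDm, if_pos (Fin.ext hx0)]
  · rw [if_neg hx0, if_neg (fun h => hx0 (by rw [h]; simp))]

/-- [cite: VysotskyRakhuba2022, Cor. 2.1]
COROLLARY 2.1 (as an inverse, over any field): under the same hypotheses `A` is invertible and
`A⁻¹ = circ(b)`, `(A⁻¹)_{jℓ} = b_{(j-ℓ) mod N}`, with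
`b_i = ∑_k w_k^{i+m-2} / (h_k(w_k)(1 - w_k^N))`. -/
theorem inv_bandCirc_eq_circulant_simpleRootCol (hm : 2 ≤ m) (hN : m + n - 1 ≤ N) {a : ℤ → K}
    (htop : a ((m : ℤ) - 1) ≠ 0) (hbot : a (-(n : ℤ)) ≠ 0) {u : Fin (m + n - 1) → K}
    (hu : Function.Injective u) (hroot : ∀ k, (hPoly m n a).eval (u k) = 0)
    (hN1 : ∀ k, u k ^ N ≠ 1) :
    (bandCirc N m n a)⁻¹ = Matrix.circulant (simpleRootCol N m n a u) :=
  inv_bandCirc_eq_circulant (bandCirc_mulVec_simpleRootCol hm hN htop hbot hu hroot hN1)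

/-- [cite: VysotskyRakhuba2022, Cor. 2.1]
COROLLARY 2.1, invertibility: "then `A` is invertible". -/
theorem isUnit_det_bandCirc_of_simpleRoots (hm : 2 ≤ m) (hN : m + n - 1 ≤ N) {a : ℤ → K}
    (htop : a ((m : ℤ) - 1) ≠ 0) (hbot : a (-(n : ℤ)) ≠ 0) {u : Fin (m + n - 1) → K}
    (hu : Function.Injective u) (hroot : ∀ k, (hPoly m n a).eval (u k) = 0)
    (hN1 : ∀ k, u k ^ N ≠ 1) : IsUnit (bandCirc N m n a).det := by
  refine Matrix.isUnit_det_of_right_inverse (B := Matrix.circulant (simpleRootCol N m n a u)) ?_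
  rw [bandCirc_eq_circulant, Matrix.circulant_mul, ← bandCirc_eq_circulant,
    bandCirc_mulVec_simpleRootCol hm hN htop hbot hu hroot hN1, Matrix.circulant_single_one]

/-- [cite: VysotskyRakhuba2022, Cor. 2.1]
COROLLARY 2.1, entrywise: `(A⁻¹)_{ij} = ∑_k w_k^{((i-j) mod N) + m - 2} / (h_k(w_k)(1 - w_k^N))`. -/
theorem inv_bandCirc_apply_of_simpleRoots (hm : 2 ≤ m) (hN : m + n - 1 ≤ N) {a : ℤ → K}
    (htop : a ((m : ℤ) - 1) ≠ 0) (hbot : a (-(n : ℤ)) ≠ 0) {u : Fin (m + n - 1) → K}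
    (hu : Function.Injective u) (hroot : ∀ k, (hPoly m n a).eval (u k) = 0)
    (hN1 : ∀ k, u k ^ N ≠ 1) (i j : Fin N) :
    (bandCirc N m n a)⁻¹ i j =
      ∑ k, u k ^ (((i - j : Fin N) : ℕ) + (m - 2)) / (hCof n a u k * (1 - u k ^ N)) := by
  rw [inv_bandCirc_eq_circulant_simpleRootCol hm hN htop hbot hu hroot hN1, Matrix.circulant_apply]
  rfl

/-- [cite: VysotskyRakhuba2022, Cor. 2.1 (with Thm. 2.1, eq. (7))]
The printed case split of formula (7): for `i ≥ j` the exponent is `m - 2 + (i - j)` … -/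
theorem inv_bandCirc_apply_of_le (hm : 2 ≤ m) (hN : m + n - 1 ≤ N) {a : ℤ → K}
    (htop : a ((m : ℤ) - 1) ≠ 0) (hbot : a (-(n : ℤ)) ≠ 0) {u : Fin (m + n - 1) → K}
    (hu : Function.Injective u) (hroot : ∀ k, (hPoly m n a).eval (u k) = 0)
    (hN1 : ∀ k, u k ^ N ≠ 1) {i j : Fin N} (hji : j ≤ i) :
    (bandCirc N m n a)⁻¹ i j =
      ∑ k, u k ^ ((m - 2) + ((i : ℕ) - j)) / (hCof n a u k * (1 - u k ^ N)) := by
  rw [inv_bandCirc_apply_of_simpleRoots hm hN htop hbot hu hroot hN1, Fin.coe_sub_iff_le.2 hji,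
    Nat.add_comm ((i : ℕ) - j) (m - 2)]

/-- [cite: VysotskyRakhuba2022, Cor. 2.1 (with Thm. 2.1, eq. (7))]
… and for `i < j` it is `m - 2 + (i - j) + N`. -/
theorem inv_bandCirc_apply_of_lt (hm : 2 ≤ m) (hN : m + n - 1 ≤ N) {a : ℤ → K}
    (htop : a ((m : ℤ) - 1) ≠ 0) (hbot : a (-(n : ℤ)) ≠ 0) {u : Fin (m + n - 1) → K}
    (hu : Function.Injective u) (hroot : ∀ k, (hPoly m n a).eval (u k) = 0)
    (hN1 : ∀ k, u k ^ N ≠ 1) {i j : Fin N} (hij : i < j) :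
    (bandCirc N m n a)⁻¹ i j =
      ∑ k, u k ^ ((m - 2) + ((N + i : ℕ) - j)) / (hCof n a u k * (1 - u k ^ N)) := by
  rw [inv_bandCirc_apply_of_simpleRoots hm hN htop hbot hu hroot hN1, Fin.coe_sub_iff_lt.2 hij,
    Nat.add_comm (N + i - j) (m - 2)]

end SimpleRoots

/-! ## G. Corollary 2.1 as printed: the roots `z_k` of `g`, `w_k = 1/z_k` of `h`, and the split of
the sum over the unit circle -/

section GPolyFacts

variable {K : Type u} [Field K] {m n : ℕ}

/-- [folklore] Reindexing the band upwards, `k = r - n`. -/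
private theorem sum_Icc_eq_sum_fin_up {M : Type*} [AddCommMonoid M] (m n : ℕ) (hmn : 1 ≤ m + n)
    (φ : ℤ → M) :
    ∑ k ∈ Icc (-(n : ℤ)) ((m : ℤ) - 1), φ k =
      ∑ r : Fin (m + n - 1 + 1), φ (((r : ℕ) : ℤ) - n) := by
  refine Finset.sum_bij' (fun k hk => ⟨(k + n).toNat, ?_⟩)
    (fun r _ => ((r : ℕ) : ℤ) - n) ?_ ?_ ?_ ?_ ?_
  · rw [Finset.mem_Icc] at hk; omega
  · intro k hk; exact Finset.mem_univ _
  · intro r _; have := r.isLt; rw [Finset.mem_Icc]; omega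
  · intro k hk; rw [Finset.mem_Icc] at hk; simp only; omega
  · intro r _; have := r.isLt; ext; simp only; omega
  · intro k hk; rw [Finset.mem_Icc] at hk; simp only; congr 1; omega

/-- [cite: VysotskyRakhuba2022, Thm. 2.1 (proof)] `g(z) = ∑_{r=0}^{m+n-1} a_{r-n} z^r`. -/
theorem gPoly_eq_sum_fin (hmn : 1 ≤ m + n) (a : ℤ → K) :
    gPoly m n a = ∑ r : Fin (m + n - 1 + 1), C (a (((r : ℕ) : ℤ) - n)) * X ^ (r : ℕ) := by
  unfold gPoly
  rw [sum_Icc_eq_sum_fin_up m n hmn]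
  refine Finset.sum_congr rfl fun r _ => ?_
  congr 2
  omega

/-- [cite: VysotskyRakhuba2022, Thm. 2.1 (proof)] The coefficient of `z^r` in `g` is `a_{r-n}`. -/
theorem coeff_gPoly (hmn : 1 ≤ m + n) (a : ℤ → K) (r : Fin (m + n - 1 + 1)) :
    (gPoly m n a).coeff (r : ℕ) = a (((r : ℕ) : ℤ) - n) := by
  rw [gPoly_eq_sum_fin hmn, finsetSum_coeff]
  simp only [coeff_C_mul_X_pow]
  rw [Finset.sum_eq_single r (fun r' _ hr' => if_neg fun h => hr' (Fin.ext h).symm)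
    (fun h => absurd (Finset.mem_univ r) h), if_pos rfl]

/-- [cite: VysotskyRakhuba2022, Thm. 2.1 (proof)] `deg g ≤ m + n - 1`. -/
theorem natDegree_gPoly_le (hmn : 1 ≤ m + n) (a : ℤ → K) :
    (gPoly m n a).natDegree ≤ m + n - 1 := by
  rw [gPoly_eq_sum_fin hmn]
  refine Polynomial.natDegree_sum_le_of_forall_le _ _ fun r _ => ?_
  have hr := r.isLt
  exact (natDegree_C_mul_X_pow_le _ _).trans (by omega)

/-- [cite: VysotskyRakhuba2022, Thm. 2.1 (proof)] For `a_{m-1} ≠ 0`, `deg g = m + n - 1`. -/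
theorem natDegree_gPoly (hmn : 1 ≤ m + n) {a : ℤ → K} (htop : a ((m : ℤ) - 1) ≠ 0) :
    (gPoly m n a).natDegree = m + n - 1 := by
  refine natDegree_eq_of_le_of_coeff_ne_zero (natDegree_gPoly_le hmn a) ?_
  have h := coeff_gPoly hmn a (Fin.last (m + n - 1))
  rw [Fin.val_last, show (((m + n - 1 : ℕ) : ℤ) - n) = (m : ℤ) - 1 by omega] at h
  rwa [h]

/-- [cite: VysotskyRakhuba2022, Thm. 2.1 (proof)] The leading coefficient of `g` is `a_{m-1}`. -/
theorem leadingCoeff_gPoly (hmn : 1 ≤ m + n) {a : ℤ → K} (htop : a ((m : ℤ) - 1) ≠ 0) :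
    (gPoly m n a).leadingCoeff = a ((m : ℤ) - 1) := by
  have h := coeff_gPoly hmn a (Fin.last (m + n - 1))
  rw [Fin.val_last, show (((m + n - 1 : ℕ) : ℤ) - n) = (m : ℤ) - 1 by omega] at h
  rw [leadingCoeff, natDegree_gPoly hmn htop, h]

/-- [cite: VysotskyRakhuba2022, Thm. 2.1 (proof)] `g ≠ 0` when `a_{m-1} ≠ 0`. -/
theorem gPoly_ne_zero (hmn : 1 ≤ m + n) {a : ℤ → K} (htop : a ((m : ℤ) - 1) ≠ 0) :
    gPoly m n a ≠ 0 :=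
  leadingCoeff_ne_zero.mp (by rw [leadingCoeff_gPoly hmn htop]; exact htop)

/-- [cite: VysotskyRakhuba2022, Thm. 2.1 (proof)] `g(0) = a_{-n}`. -/
theorem eval_zero_gPoly (hmn : 1 ≤ m + n) (a : ℤ → K) :
    (gPoly m n a).eval 0 = a (-(n : ℤ)) := by
  rw [← coeff_zero_eq_eval_zero]
  have h := coeff_gPoly hmn a 0
  rw [Fin.val_zero, Nat.cast_zero, zero_sub] at h
  exact h

/-- [cite: VysotskyRakhuba2022, Thm. 2.1 (WLOG `a_{-n} ≠ 0`)]
With `a_{-n} ≠ 0` every root `z_k` of `g` is nonzero (so `w = 1/z` is defined). -/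
theorem ne_zero_of_eval_gPoly_eq_zero (hmn : 1 ≤ m + n) {a : ℤ → K}
    (hbot : a (-(n : ℤ)) ≠ 0) {z : K} (hz : (gPoly m n a).eval z = 0) : z ≠ 0 := by
  rintro rfl
  rw [eval_zero_gPoly hmn a] at hz
  exact hbot hz

/-- [cite: VysotskyRakhuba2022, Cor. 2.1 (proof)]
SIMPLE ROOTS of `g`: with all `m + n - 1` roots `z_k` distinct, `g(z) = a_{m-1} ∏_k (z - z_k)`. -/
theorem gPoly_eq_C_mul_nodal (hmn : 1 ≤ m + n) {a : ℤ → K} (htop : a ((m : ℤ) - 1) ≠ 0)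
    {v : Fin (m + n - 1) → K} (hv : Function.Injective v)
    (hroot : ∀ k, (gPoly m n a).eval (v k) = 0) :
    gPoly m n a = C (a ((m : ℤ) - 1)) * Lagrange.nodal univ v := by
  have hnd := natDegree_gPoly hmn htop
  have hlc := leadingCoeff_gPoly hmn htop
  have hdeg : (gPoly m n a).degree = ((m + n - 1 : ℕ) : WithBot ℕ) := by
    rw [degree_eq_natDegree (gPoly_ne_zero hmn htop), hnd]
  refine Polynomial.eq_of_degree_le_of_eval_index_eq (v := v) univ hv.injOn ?_ ?_ ?_ ?_
  · rw [hdeg, card_univ, Fintype.card_fin]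
  · rw [hdeg, degree_C_mul htop, Lagrange.degree_nodal, card_univ, Fintype.card_fin]
  · rw [hlc, leadingCoeff_mul, leadingCoeff_C, Lagrange.nodal_monic.leadingCoeff, mul_one]
  · intro k _
    rw [hroot k, eval_mul, Lagrange.eval_nodal_at_node (Finset.mem_univ k), mul_zero]

/-- [cite: VysotskyRakhuba2022, Lemma 2.2 / Thm. 2.1]
`z ≠ 0` is a root of `g` iff `w = 1/z` is a root of `h` (both say `f(z) = 0`; `m ≥ 1`). -/
theorem eval_gPoly_eq_zero_iff (hm : 1 ≤ m) (a : ℤ → K) {z : K} (hz : z ≠ 0) :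
    (gPoly m n a).eval z = 0 ↔ (hPoly m n a).eval z⁻¹ = 0 := by
  rw [eval_gPoly a hz, eval_hPoly hm a (inv_ne_zero hz), inv_inv, mul_eq_zero, mul_eq_zero,
    or_iff_right (pow_ne_zero _ hz), or_iff_right (pow_ne_zero _ (inv_ne_zero hz))]

/-- [cite: VysotskyRakhuba2022, Cor. 2.1 (proof); §5.2 ("by Vieta's formulas")]
Vieta for the roots of `g`: `a_{m-1} ∏_k (-z_k) = a_{-n}` (the product of all roots is
`(-1)^{m+n-1} a_{-n}/a_{m-1}`). -/
theorem mul_prod_neg_roots_gPoly (hmn : 1 ≤ m + n) {a : ℤ → K} (htop : a ((m : ℤ) - 1) ≠ 0)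
    {v : Fin (m + n - 1) → K} (hv : Function.Injective v)
    (hroot : ∀ k, (gPoly m n a).eval (v k) = 0) :
    a ((m : ℤ) - 1) * ∏ i, (-v i) = a (-(n : ℤ)) := by
  have h := congrArg (Polynomial.eval 0) (gPoly_eq_C_mul_nodal hmn htop hv hroot)
  rw [eval_zero_gPoly hmn a, eval_mul, eval_C, Lagrange.eval_nodal] at h
  rw [h]
  simp only [zero_sub]

end GPolyFacts

section TwoFamilies

variable {K : Type u} [Field K] {d : ℕ}

/-- [cite: VysotskyRakhuba2022, Cor. 2.1]
`g_k(z_k)` for `g_k(z) = g(z)/(z - z_k)`: with all the (simple) roots `z_0, …, z_{d-1}` of `g`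
listed, `g_k(z_k) = a_{m-1} ∏_{j ≠ k} (z_k - z_j)` (`= g'(z_k)`, `gCof_eq_eval_derivative`). -/
def gCof (m : ℕ) (a : ℤ → K) (v : Fin d → K) (k : Fin d) : K :=
  a ((m : ℤ) - 1) * ∏ j ∈ univ.erase k, (v k - v j)

/-- [cite: VysotskyRakhuba2022, Cor. 2.1] `g_k(z_k) ≠ 0` for simple roots (`a_{m-1} ≠ 0`). -/
theorem gCof_ne_zero {m : ℕ} {a : ℤ → K} (htop : a ((m : ℤ) - 1) ≠ 0) {v : Fin d → K}
    (hv : Function.Injective v) (k : Fin d) : gCof m a v k ≠ 0 := by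
  refine mul_ne_zero htop (Finset.prod_ne_zero_iff.mpr fun j hj => ?_)
  exact sub_ne_zero.mpr fun h => (Finset.mem_erase.mp hj).1 (hv h).symm

variable {m n : ℕ}

/-- [cite: VysotskyRakhuba2022, Cor. 2.1] `g_k(z_k) = g'(z_k)`. -/
theorem gCof_eq_eval_derivative (hmn : 1 ≤ m + n) {a : ℤ → K} (htop : a ((m : ℤ) - 1) ≠ 0)
    {v : Fin (m + n - 1) → K} (hv : Function.Injective v)
    (hroot : ∀ k, (gPoly m n a).eval (v k) = 0) (k : Fin (m + n - 1)) :
    gCof m a v k = (derivative (gPoly m n a)).eval (v k) := by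
  rw [gPoly_eq_C_mul_nodal hmn htop hv hroot, derivative_C_mul, eval_mul, eval_C,
    Lagrange.eval_nodal_derivative_eval_node_eq (Finset.mem_univ k), Lagrange.eval_nodal, gCof]

/-- [cite: VysotskyRakhuba2022, Cor. 2.1]
`g_k(z_k)` is the value at `z_k` of `g_k(z) = g(z)/(z - z_k)` (exact polynomial division). -/
theorem gCof_eq_eval_divByMonic (hmn : 1 ≤ m + n) {a : ℤ → K} (htop : a ((m : ℤ) - 1) ≠ 0)
    {v : Fin (m + n - 1) → K} (hv : Function.Injective v)
    (hroot : ∀ k, (gPoly m n a).eval (v k) = 0) (k : Fin (m + n - 1)) :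
    gCof m a v k = (gPoly m n a /ₘ (X - C (v k))).eval (v k) := by
  rw [gPoly_eq_C_mul_nodal hmn htop hv hroot, Lagrange.nodal_eq_mul_nodal_erase (Finset.mem_univ k),
    mul_left_comm, mul_divByMonic_cancel_left _ (monic_X_sub_C _), eval_mul, eval_C,
    Lagrange.eval_nodal, gCof]

/-- [cite: VysotskyRakhuba2022, Cor. 2.1 (proof), Lemma 2.2]
THE TWO CONSTANTS ARE RELATED BY `z ↔ 1/w`: for the roots `z_k` of `g` and `w_k = 1/z_k` of `h`,
`h_k(w_k) · z_k^{m+n-2} = - g_k(z_k) · z_k` (i.e. `h'(w) = -w^{-(m+n-3)} g'(1/w)` at the roots;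
from Vieta). -/
theorem hCof_inv_mul_pow (hmn : 1 ≤ m + n) {a : ℤ → K} (htop : a ((m : ℤ) - 1) ≠ 0)
    (hbot : a (-(n : ℤ)) ≠ 0) {v : Fin (m + n - 1) → K} (hv : Function.Injective v)
    (hroot : ∀ k, (gPoly m n a).eval (v k) = 0) (k : Fin (m + n - 1)) :
    hCof n a (fun i => (v i)⁻¹) k * v k ^ (m + n - 1 - 1) = -(gCof m a v k * v k) := by
  have hv0 : ∀ i, v i ≠ 0 := fun i => ne_zero_of_eval_gPoly_eq_zero hmn hbot (hroot i)
  have hP := mul_prod_neg_roots_gPoly hmn htop hv hroot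
  have hterm : ∀ i ∈ univ.erase k, ((v k)⁻¹ - (v i)⁻¹) * (v k * -v i) = v k - v i := by
    intro i _
    have hk0 := hv0 k
    have hi0 := hv0 i
    rw [inv_sub_inv hk0 hi0]
    field_simp
    ring
  have hprod : (∏ i ∈ univ.erase k, ((v k)⁻¹ - (v i)⁻¹)) *
      (v k ^ (m + n - 1 - 1) * ∏ i ∈ univ.erase k, (-v i)) = ∏ i ∈ univ.erase k, (v k - v i) := by
    rw [← Finset.prod_congr rfl hterm, Finset.prod_mul_distrib, Finset.prod_mul_distrib,
      Finset.prod_const, Finset.card_erase_of_mem (Finset.mem_univ k), card_univ, Fintype.card_fin]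
  have key : hCof n a (fun i => (v i)⁻¹) k * v k ^ (m + n - 1 - 1) *
      (a ((m : ℤ) - 1) * ∏ i, (-v i)) = -(gCof m a v k * v k) * a (-(n : ℤ)) := by
    rw [← Finset.prod_erase_mul _ _ (Finset.mem_univ k)]
    unfold hCof gCof
    rw [← hprod]
    ring
  rw [hP] at key
  exact mul_right_cancel₀ hbot key

/-- [cite: VysotskyRakhuba2022, Cor. 2.1]
TERMWISE `z ↔ w` IDENTITY of Corollary 2.1: for a root `z_k` of `g` (`w_k = 1/z_k`) and
`0 ≤ l < N`, `w_k^{l+m-2} / (h_k(w_k)(1 - w_k^N)) = z_k^{-l+n-1+N} / (g_k(z_k)(1 - z_k^N))` — so each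
root may be entered in either form (the paper takes the one inside the unit disc). -/
theorem inv_root_term_eq (hm : 2 ≤ m) {N : ℕ} {a : ℤ → K} (htop : a ((m : ℤ) - 1) ≠ 0)
    (hbot : a (-(n : ℤ)) ≠ 0) {v : Fin (m + n - 1) → K} (hv : Function.Injective v)
    (hroot : ∀ k, (gPoly m n a).eval (v k) = 0) (k : Fin (m + n - 1)) {l : ℕ} (hl : l < N)
    (hvN : v k ^ N ≠ 1) :
    (v k)⁻¹ ^ (l + (m - 2)) / (hCof n a (fun i => (v i)⁻¹) k * (1 - (v k)⁻¹ ^ N)) =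
      v k ^ (N + n - 1 - l) / (gCof m a v k * (1 - v k ^ N)) := by
  have hmn : 1 ≤ m + n := by omega
  have hv0 : v k ≠ 0 := ne_zero_of_eval_gPoly_eq_zero hmn hbot (hroot k)
  have hg : gCof m a v k ≠ 0 := gCof_ne_zero htop hv k
  have hdag := hCof_inv_mul_pow hmn htop hbot hv hroot k
  have hU : hCof n a (fun i => (v i)⁻¹) k = -(gCof m a v k * v k) / v k ^ (m + n - 1 - 1) := by
    rw [eq_div_iff (pow_ne_zero _ hv0), hdag]
  obtain ⟨q, hq⟩ : ∃ q : ℕ, N = l + q + 1 := ⟨N - l - 1, by omega⟩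
  obtain ⟨μ, hμ⟩ : ∃ μ : ℕ, m = μ + 2 := ⟨m - 2, by omega⟩
  have e1 : l + (m - 2) = l + μ := by omega
  have e2 : N + n - 1 - l = q + n := by omega
  have e3 : m + n - 1 - 1 = μ + n := by omega
  rw [hU, e1, e2, e3, hq]
  have h1 : (1 - v k ^ (l + q + 1)) ≠ 0 := by rw [← hq]; exact sub_ne_zero.mpr hvN.symm
  have h2 : (1 - (v k ^ (l + q + 1))⁻¹) ≠ 0 := by
    rw [← hq]; exact sub_ne_zero.mpr (inv_ne_one.mpr hvN).symm
  simp only [inv_pow]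
  rw [div_eq_div_iff (mul_ne_zero (div_ne_zero (neg_ne_zero.mpr (mul_ne_zero hg hv0))
    (pow_ne_zero _ hv0)) h2) (mul_ne_zero hg h1)]
  field_simp
  ring

variable {N : ℕ} [NeZero N]

/-- [cite: VysotskyRakhuba2022, Cor. 2.1]
COROLLARY 2.1 WITH BOTH FAMILIES (over any field): let `z_0, …, z_{m+n-2}` be the `m + n - 1`
distinct roots of `g` (all simple; `z_k ≠ 0` as `a_{-n} ≠ 0`), `z_k^N ≠ 1`, and `w_k = 1/z_k` the
roots of `h`.  For ANY set `S` of indices,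
`(A⁻¹)_{ij} = ∑_{k ∈ S} z_k^{-l+n-1+N} / (g_k(z_k)(1 - z_k^N))
            + ∑_{k ∉ S} w_k^{l+m-2} / (h_k(w_k)(1 - w_k^N))`, `l = (i - j) mod N`
— the printed `b_j`, which takes `S = {k : |z_k| < 1}`. -/
theorem inv_bandCirc_apply_eq_sum_add_sum (hm : 2 ≤ m) (hN : m + n - 1 ≤ N) {a : ℤ → K}
    (htop : a ((m : ℤ) - 1) ≠ 0) (hbot : a (-(n : ℤ)) ≠ 0) {v : Fin (m + n - 1) → K}
    (hv : Function.Injective v) (hroot : ∀ k, (gPoly m n a).eval (v k) = 0)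
    (hvN : ∀ k, v k ^ N ≠ 1) (S : Finset (Fin (m + n - 1))) (i j : Fin N) :
    (bandCirc N m n a)⁻¹ i j =
      ∑ k ∈ S, v k ^ (N + n - 1 - ((i - j : Fin N) : ℕ)) / (gCof m a v k * (1 - v k ^ N)) +
      ∑ k ∈ Sᶜ, (v k)⁻¹ ^ (((i - j : Fin N) : ℕ) + (m - 2)) /
          (hCof n a (fun i => (v i)⁻¹) k * (1 - (v k)⁻¹ ^ N)) := by
  have hmn : 1 ≤ m + n := by omega
  have hv0 : ∀ k, v k ≠ 0 := fun k => ne_zero_of_eval_gPoly_eq_zero hmn hbot (hroot k)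
  have hu : Function.Injective (fun i => (v i)⁻¹) := fun i j h => hv (inv_injective h)
  have hroot' : ∀ k, (hPoly m n a).eval (v k)⁻¹ = 0 := fun k =>
    (eval_gPoly_eq_zero_iff (by omega) a (hv0 k)).1 (hroot k)
  have hN1 : ∀ k, (fun i => (v i)⁻¹) k ^ N ≠ 1 := fun k => by
    simp only [inv_pow]
    exact inv_ne_one.mpr (hvN k)
  rw [inv_bandCirc_apply_of_simpleRoots hm hN htop hbot hu hroot' hN1, ← Finset.sum_add_sum_compl S]
  congr 1
  refine Finset.sum_congr rfl fun k _ => ?_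
  exact inv_root_term_eq hm htop hbot hv hroot k (i - j).isLt (hvN k)

/-- [cite: VysotskyRakhuba2022, Cor. 2.1]
COROLLARY 2.1 AS PRINTED (over `ℂ`): "if both `g(z)` and `h(z)` have only simple roots inside the
unit circle `U`" — here: the `m + n - 1` roots `z_k` of `g` are distinct and none lies on `U` — "then
`A` is invertible and `B_{jℓ} = b_{(j-ℓ) mod N}`,
`b_l = ∑_{|z_k|<1} z_k^{-l+n-1+N} / (g_k(z_k)(1 - z_k^N))
     + ∑_{|w_k|<1} w_k^{l+m-2} / (h_k(w_k)(1 - w_k^N))`",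
the second sum over the roots `w_k = 1/z_k` of `h` inside `U`. -/
theorem inv_bandCirc_apply_complex {m n N : ℕ} [NeZero N] (hm : 2 ≤ m) (hN : m + n - 1 ≤ N)
    {a : ℤ → ℂ} (htop : a ((m : ℤ) - 1) ≠ 0) (hbot : a (-(n : ℤ)) ≠ 0)
    {z : Fin (m + n - 1) → ℂ} (hz : Function.Injective z)
    (hroot : ∀ k, (gPoly m n a).eval (z k) = 0) (hU : ∀ k, ‖z k‖ ≠ 1) (i j : Fin N) :
    (bandCirc N m n a)⁻¹ i j =
      ∑ k ∈ univ.filter (fun k => ‖z k‖ < 1),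
          z k ^ (N + n - 1 - ((i - j : Fin N) : ℕ)) / (gCof m a z k * (1 - z k ^ N)) +
      ∑ k ∈ univ.filter (fun k => ‖(z k)⁻¹‖ < 1),
          (z k)⁻¹ ^ (((i - j : Fin N) : ℕ) + (m - 2)) /
            (hCof n a (fun i => (z i)⁻¹) k * (1 - (z k)⁻¹ ^ N)) := by
  have hzN : ∀ k, z k ^ N ≠ 1 := fun k h => by
    have h' := congrArg norm h
    rw [norm_pow, norm_one] at h'
    rcases ((hU k).lt_or_gt) with hlt | hgt
    · exact (pow_lt_one₀ (norm_nonneg _) hlt (NeZero.ne N)).ne h'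
    · exact (one_lt_pow₀ hgt (NeZero.ne N)).ne' h'
  rw [inv_bandCirc_apply_eq_sum_add_sum hm hN htop hbot hz hroot hzN
    (univ.filter fun k => ‖z k‖ < 1) i j]
  congr 1
  refine Finset.sum_congr ?_ fun _ _ => rfl
  ext k
  have hz0 : z k ≠ 0 := ne_zero_of_eval_gPoly_eq_zero (by omega) hbot (hroot k)
  simp only [Finset.mem_compl, Finset.mem_filter, Finset.mem_univ, true_and, norm_inv]
  rw [inv_lt_one₀ (norm_pos_iff.mpr hz0)]
  exact ⟨fun h => ((hU k).lt_or_gt).resolve_left h, fun h => not_lt.mpr h.le⟩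

/-- [cite: VysotskyRakhuba2022, Cor. 2.1]
COROLLARY 2.1, invertibility clause over `ℂ`: `m + n - 1` distinct roots of `g`, none on the unit
circle (`m ≥ 2`, `a_{m-1} ≠ 0 ≠ a_{-n}`, `m + n - 1 ≤ N`) ⟹ `A` is invertible. -/
theorem isUnit_det_bandCirc_complex {m n N : ℕ} [NeZero N] (hm : 2 ≤ m) (hN : m + n - 1 ≤ N)
    {a : ℤ → ℂ} (htop : a ((m : ℤ) - 1) ≠ 0) (hbot : a (-(n : ℤ)) ≠ 0)
    {z : Fin (m + n - 1) → ℂ} (hz : Function.Injective z)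
    (hroot : ∀ k, (gPoly m n a).eval (z k) = 0) (hU : ∀ k, ‖z k‖ ≠ 1) :
    IsUnit (bandCirc N m n a).det := by
  have hmn : 1 ≤ m + n := by omega
  have hz0 : ∀ k, z k ≠ 0 := fun k => ne_zero_of_eval_gPoly_eq_zero hmn hbot (hroot k)
  have hu : Function.Injective (fun i => (z i)⁻¹) := fun i j h => hz (inv_injective h)
  have hroot' : ∀ k, (hPoly m n a).eval (z k)⁻¹ = 0 := fun k =>
    (eval_gPoly_eq_zero_iff (by omega) a (hz0 k)).1 (hroot k)
  have hN1 : ∀ k, (fun i => (z i)⁻¹) k ^ N ≠ 1 := fun k h => by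
    have h' := congrArg norm h
    simp only [norm_pow, norm_inv, norm_one] at h'
    rcases ((hU k).lt_or_gt) with hlt | hgt
    · exact (one_lt_pow₀ ((one_lt_inv₀ (norm_pos_iff.mpr (hz0 k))).2 hlt) (NeZero.ne N)).ne' h'
    · exact (pow_lt_one₀ (inv_nonneg.mpr (norm_nonneg _)) (inv_lt_one_of_one_lt₀ hgt)
        (NeZero.ne N)).ne h'
  exact isUnit_det_bandCirc_of_simpleRoots hm hN htop hbot hu hroot' hN1

end TwoFamilies

/-! ## H. Section 4: the explicit QTT representation of `A⁻¹` for simple roots -/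

section QTT

variable {K : Type u} [Field K] {L m n : ℕ}

/-- [cite: VysotskyRakhuba2022, §4]
"we obtain explicit formulas for QTT representation of matrices `A⁻¹` … with the ranks
`(2, m+n, …, m+n)`": the bond dimensions of the exponential-sum train on the `m + n - 1` roots are
`m + n` (the first unfolding has rank `≤ 2`, `rank_unfolding_expSumTrain_first_le`). -/
theorem r_expSumTrain_roots (hmn : 1 ≤ m + n) (c w : Fin (m + n - 1) → K)
    (rv : Fin (m + n - 1) → Bool) (L i : ℕ) : (expSumTrain K c w rv L).r i = m + n := by
  rw [r_expSumTrain]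
  omega

/-- [cite: VysotskyRakhuba2022, §4 (Cor. 2.1 with Prop. 4.1)]
SECTION 4, CONCLUSION (simple roots, `N = 2^L`, over any field): `A⁻¹ = circ(b)` with
`b_j = ∑_k α_k w_k^j`, `α_k = w_k^{m-2} / (h_k(w_k)(1 - w_k^N))`, IS the matrix represented by the
explicit train `Q_1 ⋈ ⋯ ⋈ Q_L` of Proposition 4.1 on the nodes `w_k` with weights `α_k` — an explicit
QTT representation of `A⁻¹` with ranks `(2, m+n, …, m+n)`. -/
theorem inv_bandCirc_eq_qttMatrix_expSumTrain (hm : 2 ≤ m) (hN : m + n - 1 ≤ 2 ^ L) {a : ℤ → K}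
    (htop : a ((m : ℤ) - 1) ≠ 0) (hbot : a (-(n : ℤ)) ≠ 0) {u : Fin (m + n - 1) → K}
    (hu : Function.Injective u) (hroot : ∀ k, (hPoly m n a).eval (u k) = 0)
    (hN1 : ∀ k, u k ^ (2 ^ L) ≠ 1) :
    (bandCirc (2 ^ L) m n a)⁻¹ =
      (expSumTrain K (fun k => u k ^ (m - 2) / (hCof n a u k * (1 - u k ^ (2 ^ L)))) u
        (fun _ => false) L).qttMatrix := by
  haveI : NeZero (2 ^ L) := ⟨pow_ne_zero _ two_ne_zero⟩
  rw [qttMatrix_expSumTrain_prop41,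
    inv_bandCirc_eq_circulant_simpleRootCol hm hN htop hbot hu hroot hN1]
  congr 1
  funext j
  unfold simpleRootCol
  refine Finset.sum_congr rfl fun k _ => ?_
  rw [pow_add]
  ring

/-- [cite: VysotskyRakhuba2022, §4 (Cor. 2.1 with Cor. 4.1)]
The same with an arbitrary orientation flag per root (Corollary 4.1's numerically stable mixed form:
a root `w_k` with `|w_k| > 1` is entered as `z = 1/w_k` with the reversed exponent `z^{2^L - j}` and
weight `β = α_k w_k^{2^L}`): every such train also represents `A⁻¹`. -/
theorem inv_bandCirc_eq_qttMatrix_expSumTrain_flag (hm : 2 ≤ m) (hN : m + n - 1 ≤ 2 ^ L)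
    {a : ℤ → K} (htop : a ((m : ℤ) - 1) ≠ 0) (hbot : a (-(n : ℤ)) ≠ 0)
    {u : Fin (m + n - 1) → K} (hu : Function.Injective u)
    (hroot : ∀ k, (hPoly m n a).eval (u k) = 0) (hN1 : ∀ k, u k ^ (2 ^ L) ≠ 1)
    (rv : Fin (m + n - 1) → Bool) :
    (bandCirc (2 ^ L) m n a)⁻¹ =
      (expSumTrain K
        (fun k => if rv k then u k ^ (m - 2) * u k ^ (2 ^ L) / (hCof n a u k * (1 - u k ^ (2 ^ L)))
          else u k ^ (m - 2) / (hCof n a u k * (1 - u k ^ (2 ^ L))))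
        (fun k => if rv k then (u k)⁻¹ else u k) rv L).qttMatrix := by
  haveI : NeZero (2 ^ L) := ⟨pow_ne_zero _ two_ne_zero⟩
  have hu0 : ∀ k, u k ≠ 0 := fun k => ne_zero_of_eval_hPoly_eq_zero (by omega) htop (hroot k)
  rw [qttMatrix_expSumTrain, inv_bandCirc_eq_circulant_simpleRootCol hm hN htop hbot hu hroot hN1]
  congr 1
  funext j
  unfold simpleRootCol
  refine Finset.sum_congr rfl fun k _ => ?_
  have hj := j.isLt
  by_cases hrv : rv k = true
  · simp only [if_pos hrv]
    have hc := hCof_ne_zero hbot hu k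
    have h1 : (1 - u k ^ (2 ^ L)) ≠ 0 := sub_ne_zero.mpr (hN1 k).symm
    have hsplit : u k ^ (2 ^ L) = u k ^ (2 ^ L - (j : ℕ)) * u k ^ (j : ℕ) := by
      rw [← pow_add, Nat.sub_add_cancel hj.le]
    have hp : u k ^ (2 ^ L - (j : ℕ)) ≠ 0 := pow_ne_zero _ (hu0 k)
    rw [inv_pow, hsplit, pow_add]
    field_simp
  · simp only [if_neg hrv]
    rw [pow_add]
    ring

end QTT

/-! ## I. Section 5: the mass matrix and the shifted stiffness matrix -/

section Examples

variable {K : Type u} [Field K]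

/-- [folklore] `univ.erase 0 = {1}` in `Fin 2`. -/
private theorem hCof_two_zero (n : ℕ) (a : ℤ → K) (u : Fin 2 → K) :
    hCof n a u 0 = a (-(n : ℤ)) * (u 0 - u 1) := by
  rw [hCof, show (univ : Finset (Fin 2)).erase 0 = {1} by decide, Finset.prod_singleton]

/-- [folklore] `univ.erase 1 = {0}` in `Fin 2`. -/
private theorem hCof_two_one (n : ℕ) (a : ℤ → K) (u : Fin 2 → K) :
    hCof n a u 1 = a (-(n : ℤ)) * (u 1 - u 0) := by
  rw [hCof, show (univ : Finset (Fin 2)).erase 1 = {0} by decide, Finset.prod_singleton]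

omit [Field K] in
/-- [folklore] A pair with distinct entries is an injective family. -/
private theorem injective_vec_two {x y : K} (h : x ≠ y) : Function.Injective ![x, y] := by
  intro i j hij
  fin_cases i <;> fin_cases j
  · rfl
  · exact absurd hij h
  · exact absurd hij.symm h
  · rfl

/-- [cite: VysotskyRakhuba2022, §5 (m = 2, n = 1)]
For the tridiagonal stencils of Section 5 (`m = 2`, `n = 1`): `h(w) = a_{-1} w² + a_0 w + a_1`. -/
theorem eval_hPoly_two_one (a : ℤ → K) (w : K) :
    (hPoly 2 1 a).eval w = a (-1) * w ^ 2 + a 0 * w + a 1 := by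
  rw [hPoly_eq_sum_bandCoeff (by norm_num : 1 ≤ 2 + 1)]
  simp only [Fin.sum_univ_succ, Fin.sum_univ_zero, bandCoeff]
  norm_num
  ring

/-- [cite: VysotskyRakhuba2022, §5.1–5.2 (via Cor. 2.1)]
SYMMETRIC TRIDIAGONAL CIRCULANTS `circ(a_0, c, 0, …, 0, c)` (`m = 2`, `n = 1`, `a_1 = a_{-1} = c ≠ 0`,
any field): if `z ≠ 0` is a root of `h(w) = c w² + a_0 w + c` with `z² ≠ 1` (so the roots `z, 1/z`
are simple) and `z^N ≠ 1`, then
`(A⁻¹)_{i0} = (z^{N-i} + z^i) / (c (z - z⁻¹) (1 - z^N))` — the common shape of §5.1 and §5.2. -/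
theorem inv_bandCirc_two_one_symm {N : ℕ} [NeZero N] (hN : 2 ≤ N) {a : ℤ → K}
    (hsymm : a 1 = a (-1)) (hc : a (-1) ≠ 0) {z : K} (hz0 : z ≠ 0)
    (hz : a (-1) * z ^ 2 + a 0 * z + a (-1) = 0) (hz2 : z ^ 2 ≠ 1) (hzN : z ^ N ≠ 1) :
    (bandCirc N 2 1 a)⁻¹ = Matrix.circulant fun i : Fin N =>
      (z ^ (N - (i : ℕ)) + z ^ (i : ℕ)) / (a (-1) * (z - z⁻¹) * (1 - z ^ N)) := by
  have hzz : z ≠ z⁻¹ := by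
    intro h
    apply hz2
    have : z * z = z * z⁻¹ := by rw [← h]
    rw [mul_inv_cancel₀ hz0] at this
    rw [pow_two, this]
  have hroot1 : a (-1) * z⁻¹ ^ 2 + a 0 * z⁻¹ + a (-1) = 0 := by
    have e : a (-1) * z⁻¹ ^ 2 + a 0 * z⁻¹ + a (-1) = (a (-1) * z ^ 2 + a 0 * z + a (-1)) / z ^ 2 := by
      field_simp
      ring
    rw [e, hz, zero_div]
  rw [inv_bandCirc_eq_circulant_simpleRootCol (N := N) (m := 2) (n := 1) (a := a) (u := ![z, z⁻¹])
    le_rfl (by omega) (by simpa [hsymm] using hc) (by simpa using hc) (injective_vec_two hzz)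
    (Fin.forall_fin_two.2 ⟨by simpa [eval_hPoly_two_one, hsymm] using hz,
      by simpa [eval_hPoly_two_one, hsymm] using hroot1⟩)
    (Fin.forall_fin_two.2 ⟨by simpa using hzN, by simpa [inv_pow] using hzN⟩)]
  congr 1
  funext i
  have hi := i.isLt
  have h1 : (1 - z ^ N) ≠ 0 := sub_ne_zero.mpr (Ne.symm hzN)
  have h1' : (z ^ N - 1) ≠ 0 := sub_ne_zero.mpr hzN
  have hd : z - z⁻¹ ≠ 0 := sub_ne_zero.mpr hzz
  have hd' : z⁻¹ - z ≠ 0 := sub_ne_zero.mpr (Ne.symm hzz)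
  have hzN0 : z ^ N ≠ 0 := pow_ne_zero _ hz0
  have hzi0 : z ^ (i : ℕ) ≠ 0 := pow_ne_zero _ hz0
  simp only [simpleRootCol, Nat.sub_self, add_zero]
  rw [Fin.sum_univ_two, hCof_two_zero, hCof_two_one]
  simp only [Matrix.cons_val_zero, Matrix.cons_val_one]
  rw [show ((-((1 : ℕ) : ℤ)) : ℤ) = -1 by norm_num, inv_pow, inv_pow, pow_sub₀ _ hz0 hi.le]
  field_simp
  ring

/-- [folklore] A real number with `|x| < 1` or `|x| > 1` has no positive power equal to `1`. -/
private theorem pow_ne_one_of_abs {x : ℝ} (hx : |x| < 1 ∨ 1 < |x|) {N : ℕ} (hN : N ≠ 0) :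
    x ^ N ≠ 1 := by
  intro h
  have h' : |x| ^ N = 1 := by rw [← abs_pow, h, abs_one]
  rcases hx with hx | hx
  · exact (pow_lt_one₀ (abs_nonneg x) hx hN).ne h'
  · exact (one_lt_pow₀ hx hN).ne' h'

/-- [cite: VysotskyRakhuba2022, §5.1]
The stencil of the (scaled, periodic, P1 finite element) MASS MATRIX `M = circ(4, 1, 0, …, 0, 1)`:
`a_0 = 4`, `a_{±1} = 1` (`m = 2`, `n = 1`; values off `[-1, 1]` are not read). -/
def massStencil : ℤ → ℝ := fun k => if k = 0 then 4 else 1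

/-- [cite: VysotskyRakhuba2022, §5.1]
§5.1: "`(M⁻¹)_{i,0} = ((√3-2)^{N-i} + (√3-2)^i) / (2√3 (1 - (√3-2)^N))`" — the roots of
`g = h = 1 + 4z + z²` being `z_{1,2} = -2 ± √3`, `z_1 z_2 = 1`.  (Any `N ≥ 2`.) -/
theorem inv_massMatrix (N : ℕ) [NeZero N] (hN : 2 ≤ N) :
    (bandCirc N 2 1 massStencil)⁻¹ = Matrix.circulant fun i : Fin N =>
      ((Real.sqrt 3 - 2) ^ (N - (i : ℕ)) + (Real.sqrt 3 - 2) ^ (i : ℕ)) /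
        (2 * Real.sqrt 3 * (1 - (Real.sqrt 3 - 2) ^ N)) := by
  set s := Real.sqrt 3 with hs
  have hs2 : s * s = 3 := Real.mul_self_sqrt (by norm_num)
  have hs0 : 0 < s := Real.sqrt_pos.2 (by norm_num)
  have hz0 : s - 2 ≠ 0 := by nlinarith
  have hinv : (s - 2)⁻¹ = -s - 2 :=
    (eq_inv_of_mul_eq_one_right (by nlinarith : (s - 2) * (-s - 2) = 1)).symm
  have habs : |s - 2| < 1 := by rw [abs_lt]; constructor <;> nlinarith
  have hz2 : (s - 2) ^ 2 ≠ 1 := pow_ne_one_of_abs (Or.inl habs) two_ne_zero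
  have hzN : (s - 2) ^ N ≠ 1 := pow_ne_one_of_abs (Or.inl habs) (NeZero.ne N)
  have hroot : massStencil (-1) * (s - 2) ^ 2 + massStencil 0 * (s - 2) + massStencil (-1) = 0 := by
    simp [massStencil]
    nlinarith
  have hm1 : massStencil (-1) = 1 := by simp [massStencil]
  rw [inv_bandCirc_two_one_symm hN (by simp [massStencil]) (by simp [massStencil]) hz0 hroot hz2 hzN]
  congr 1
  funext i
  rw [hinv, hm1]
  ring

/-- [cite: VysotskyRakhuba2022, §5.2]
The stencil of the SHIFTED STIFFNESS MATRIX `S + σI = circ(2+σ, -1, 0, …, 0, -1)`: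
`a_0 = 2 + σ`, `a_{±1} = -1` (`m = 2`, `n = 1`). -/
def stiffStencil (σ : ℝ) : ℤ → ℝ := fun k => if k = 0 then 2 + σ else -1

/-- [cite: VysotskyRakhuba2022, §5.2]
§5.2: for `σ > 0`, with `z_1 = 1 + σ/2 - √(σ²/4 + σ)` (the root of `g = h = -1 + (2+σ)z - z²` inside
the unit disc; `z_1 z_2 = 1`):
"`((S + σI)⁻¹)_{i,0} = (z_1^{N-i} + z_1^i) / (√(σ²+4σ) (1 - z_1^N))`".  (Any `N ≥ 2`.) -/
theorem inv_shiftedStiffness (N : ℕ) [NeZero N] (hN : 2 ≤ N) {σ : ℝ} (hσ : 0 < σ) :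
    (bandCirc N 2 1 (stiffStencil σ))⁻¹ = Matrix.circulant fun i : Fin N =>
      ((1 + σ / 2 - Real.sqrt (σ ^ 2 / 4 + σ)) ^ (N - (i : ℕ)) +
          (1 + σ / 2 - Real.sqrt (σ ^ 2 / 4 + σ)) ^ (i : ℕ)) /
        (Real.sqrt (σ ^ 2 + 4 * σ) * (1 - (1 + σ / 2 - Real.sqrt (σ ^ 2 / 4 + σ)) ^ N)) := by
  set t := Real.sqrt (σ ^ 2 / 4 + σ) with ht
  have ht2 : t * t = σ ^ 2 / 4 + σ := Real.mul_self_sqrt (by positivity)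
  have ht0 : 0 < t := Real.sqrt_pos.2 (by positivity)
  have hbig : Real.sqrt (σ ^ 2 + 4 * σ) = 2 * t := by
    rw [show σ ^ 2 + 4 * σ = 2 ^ 2 * (σ ^ 2 / 4 + σ) by ring, Real.sqrt_mul (by norm_num),
      Real.sqrt_sq (by norm_num)]
  set z := 1 + σ / 2 - t with hzdef
  have hprod : z * (1 + σ / 2 + t) = 1 := by rw [hzdef]; nlinarith
  have hzpos : 0 < z := by rw [hzdef]; nlinarith
  have hzlt : z < 1 := by rw [hzdef]; nlinarith
  have hz0 : z ≠ 0 := hzpos.ne'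
  have hinv : z⁻¹ = 1 + σ / 2 + t := (eq_inv_of_mul_eq_one_right hprod).symm
  have habs : |z| < 1 := by rw [abs_lt]; constructor <;> linarith
  have hz2 : z ^ 2 ≠ 1 := pow_ne_one_of_abs (Or.inl habs) two_ne_zero
  have hzN : z ^ N ≠ 1 := pow_ne_one_of_abs (Or.inl habs) (NeZero.ne N)
  have hroot : stiffStencil σ (-1) * z ^ 2 + stiffStencil σ 0 * z + stiffStencil σ (-1) = 0 := by
    simp [stiffStencil]
    rw [hzdef]
    nlinarith
  have hs1 : stiffStencil σ (-1) = -1 := by simp [stiffStencil]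
  rw [inv_bandCirc_two_one_symm hN (by simp [stiffStencil]) (by simp [stiffStencil]) hz0 hroot hz2
    hzN, hbig]
  congr 1
  funext i
  rw [hinv, hs1, hzdef]
  ring

end Examples

end Literature.LinearAlgebra.TensorNetworks.BandCirculant
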